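import Summits.BirchSwinnertonDyer.Rank1Residual.Additive.RamifiedOrdinaryLineMatchingLineExponent
import HarnessLib

/-!
# NO matching of ramified ordinary lines on the GENUINE swap locus: a line exponent `ℓ` on `E`
# and a quotient exponent `n₁` on `E₁` with `(p − 1) ∤ lcm(ℓ, n₁)` FORBID `e(C[p]) = C₁[p]` for
# every inertia-equivariant `e : E[p] ≃ E₁[p]` (MIXED parity at `ℓ = n₁ = (p−1)/2`) — model-free

HONEST FRAMING (BSD rank-`≤ 1` residual cell `b2b-bsdres`, home
`run/shared/lean/b2b/bsd-rank1-residual/`, lane CLASS-CLOSURE, seat cc-typer-2 = typer of record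
N10 §3.2 / O7 §3.3, team n1011; typer-lane sequel S4b of S4 = `RamifiedOrdinaryLineMatchingLineExponent`):
research route, no claim beyond stated classes; census output = EVIDENCE; nothing is booked by this
file; no RESIDUAL-MAP mark moves. Theorems only: NO definition, NO named fact, NO conjecture node.

WHAT. S3/S4 give SUFFICIENT conditions for the ramified ordinary lines of two curves to match under a
congruence `E[p] ≃ E₁[p]` (equal "parity"). This file proves the complementary NEGATIVE statement,
turning S4's "nothing claimed on mixed pairs" into a theorem: if the local inertia group acts on
`C ∩ E[p^∞][p]` through exponent `ℓ` and on `E₁[p^∞]/C₁` through exponent `n₁` with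
`(p − 1) ∤ lcm(ℓ, n₁)` — at `ℓ = n₁ = (p−1)/2`: `E` LINE-even and `E₁` QUOTIENT-even — then NO
inertia-equivariant additive isomorphism `e : E[p] ≃ E₁[p]` maps `C[p]` onto `C₁[p]`
(`not_forall_mem_iff_of_linePow_of_quotPow`, §2). MECHANISM: if `e(C[p]) = C₁[p]`, the line scalars
of one inertia element `σ` on `E` and on `E₁` agree mod `p` (§1 `lineScalar_eq_of_mem_of_mem`: both
act on the non-zero element `e P ∈ C₁[p]`); with `χ_p(σ) ≡ g₀` a primitive root, `a^ℓ ≡ 1` (line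
exponent on `E`), `b₁^{n₁} ≡ 1` (quotient exponent on `E₁`) and `a₁ b₁ ≡ g₀` (Weil pairing on `E₁`)
give `g₀^{lcm(ℓ,n₁)} ≡ 1`, i.e. `(p − 1) ∣ lcm(ℓ, n₁)`. CONSEQUENCE for the class-closure relation
tables (r2 ROUTE-2 §II.25/26, cc-eng-3 `S3OK-v1`): a congruence link between rows of OPPOSITE parity
(parity table of S4's docstring / `N10/TRANSPORT-TEMPLATE.md` v2.1 — e.g. `(5; 4, 2)`, `(5; 4, M)`,
`(5; 4, good ordinary)`, `(7; 6, 3)`, `(7; 6, good ordinary)`, `(13; 4, 3)`) can NEVER carry a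
Greenberg–Vatsal / EPW transfer in its line-respecting form — DEAD BY THEOREM (modulo the per-curve
producers of the parity exponents, as for S4), not merely "untyped". In particular an `e = 4` row at
`p ≡ 5 (mod 8)` (all `(5; 4)` rows) has NO equal-parity partner type other than `e = 4` rows.

References: Greenberg–Vatsal, Invent. Math. 142 (2000) §2 p. 26, Remark (2.9) [GreenbergVatsal2000];
Emerton–Pollack–Weston (2006) pp. 2–3, §3.1 ("the congruence respects the `p`-stabilisations" as a
HYPOTHESIS) [EmertonPollackWeston2006]; Silverman *AEC* III.8.1 [SilvermanAEC2009]; Serre, *Local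
Fields* IV §4 Prop. 17 [SerreLocalFields1979].
-/

noncomputable section

open scoped Classical AddSubgroup

open NumberField IsDedekindDomain Field
  Literature.NumberTheory.GaloisRepresentations
  Literature.NumberTheory.EllipticCurves
  Literature.NumberTheory.EllipticCurves.GreenbergSelmer
  Literature.NumberTheory.EllipticCurves.EmertonPollackWeston2006
  IsDedekindDomain.HeightOneSpectrum
  Summit.BirchSwinnertonDyer.Rank1Residual.X2
  Summit.BirchSwinnertonDyer.Rank1Residual.X2.GreenbergVatsalTateDatumTorsion
  Summit.BirchSwinnertonDyer.Rank1Residual.Additive.RamifiedOrdinaryLineUniqueModelFree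
  Summit.BirchSwinnertonDyer.Rank1Residual.AdditivePotMult.RamifiedLineUnique
open WeierstrassCurve (geomTorsion geomPrimaryTorsion geomTorsion_le_geomPrimaryTorsion)

open Summit.BirchSwinnertonDyer.Rank1Residual.Additive.RamifiedOrdinaryLineInertiaScalars
  Summit.BirchSwinnertonDyer.Rank1Residual.Additive.RamifiedOrdinaryLineMatchingModelFree
  Summit.BirchSwinnertonDyer.Rank1Residual.Additive.RamifiedOrdinaryLineMatchingLineExponent

namespace Summit.BirchSwinnertonDyer.Rank1Residual.Additive.RamifiedOrdinaryLineNoMatchingMixedParity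

variable {W W₁ : WeierstrassCurve ℚ} [W.IsElliptic] [W₁.IsElliptic] {p : ℕ} [hp : Fact p.Prime]
  {v : HeightOneSpectrum (𝓞 ℚ)}

/-! ## §1. A non-zero `p`-torsion point on the line, and equality of line scalars under a matching -/

omit [W.IsElliptic] hp in
/-- The inclusion `E[p] ↪ E[p^∞]` of a `p`-torsion point is killed by `p`. [folklore] -/
private theorem nsmul_inclusion_eq_zero (P : ↥(geomTorsion W (p : ℤ))) :
    p • AddSubgroup.inclusion (geomTorsion_le_geomPrimaryTorsion W p) P = 0 :=
  Subtype.ext (by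
    rw [AddSubmonoidClass.coe_nsmul, ZeroMemClass.coe_zero]
    exact AddSubgroup.torsionBy.nsmul_iff.mp P.2)

/-- **A non-zero point of `E[p]` on the line.** For a ramified ordinary line (`#(C ∩ E[p^∞][p]) = p`)
there is `P ∈ E[p]`, `P ≠ 0`, whose image in `E[p^∞]` lies in `C`. [cite: GreenbergVatsal2000, §2 p. 14] -/
theorem exists_ne_zero_inclusion_mem {L : LocalDatum ℚ ↥(W.geomPrimaryTorsion p) v}
    (hL : IsRamifiedOrdinaryLine W p L) :
    ∃ P : ↥(geomTorsion W (p : ℤ)), P ≠ 0 ∧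
      AddSubgroup.inclusion (geomTorsion_le_geomPrimaryTorsion W p) P ∈ L.plus := by
  have hCp := natCard_plus_inf_torsionBy_eq hL
  set K : AddSubgroup ↥(W.geomPrimaryTorsion p) :=
    L.plus ⊓ (↥(W.geomPrimaryTorsion p))[(p : ℤ)] with hK
  haveI : Finite ↥K := Nat.finite_of_card_ne_zero (by rw [hCp]; exact hp.out.ne_zero)
  have hKne : K ≠ ⊥ := (AddSubgroup.one_lt_card_iff_ne_bot K).mp (by rw [hCp]; exact hp.out.one_lt)
  obtain ⟨x₀, hx₀⟩ := (AddSubgroup.ne_bot_iff_exists_ne_zero).mp hKne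
  have ht₀S : (x₀ : ↥(W.geomPrimaryTorsion p)) ∈ L.plus := (AddSubgroup.mem_inf.1 x₀.2).1
  have ht₀p : (x₀ : ↥(W.geomPrimaryTorsion p)) ∈ (↥(W.geomPrimaryTorsion p))[(p : ℤ)] :=
    (AddSubgroup.mem_inf.1 x₀.2).2
  have ht₀ : (x₀ : ↥(W.geomPrimaryTorsion p)) ≠ 0 := fun h ↦ hx₀ (Subtype.ext h)
  -- the underlying geometric point is `p`-torsion
  have ht₀p' : p • (x₀ : ↥(W.geomPrimaryTorsion p)) = 0 := AddSubgroup.torsionBy.nsmul_iff.mp ht₀p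
  have hmem : ((x₀ : ↥(W.geomPrimaryTorsion p)) : W.geomPoints) ∈ geomTorsion W (p : ℤ) := by
    apply AddSubgroup.torsionBy.nsmul_iff.mpr
    have h := congrArg Subtype.val ht₀p'
    simpa only [AddSubmonoidClass.coe_nsmul, ZeroMemClass.coe_zero] using h
  refine ⟨⟨((x₀ : ↥(W.geomPrimaryTorsion p)) : W.geomPoints), hmem⟩, ?_, ?_⟩
  · intro h
    apply ht₀
    have h' : ((x₀ : ↥(W.geomPrimaryTorsion p)) : W.geomPoints) = 0 := by
      have h2 := congrArg Subtype.val h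
      simpa only [ZeroMemClass.coe_zero] using h2
    exact Subtype.ext h'
  · have hincl : AddSubgroup.inclusion (geomTorsion_le_geomPrimaryTorsion W p)
        ⟨((x₀ : ↥(W.geomPrimaryTorsion p)) : W.geomPoints), hmem⟩ =
        (x₀ : ↥(W.geomPrimaryTorsion p)) := Subtype.ext rfl
    rw [hincl]
    exact ht₀S

omit [W.IsElliptic] [W₁.IsElliptic] in
/-- **Line scalars agree under a matching at one point.** If `g ∈ Γ_ℚ` acts on `C ∩ E[p^∞][p]` as
`a` and on `C₁ ∩ E₁[p^∞][p]` as `a₁`, `e : E[p] ≃+ E₁[p]` commutes with `g`, and some `P ≠ 0` in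
`E[p]` has `P ∈ C` and `e P ∈ C₁`, then `a ≡ a₁ (mod p)` (both act on `e P ≠ 0`, of order `p`).
[cite: GreenbergVatsal2000, §2 p. 26] -/
theorem lineScalar_eq_of_mem_of_mem
    (L : LocalDatum ℚ ↥(W.geomPrimaryTorsion p) v) (L₁ : LocalDatum ℚ ↥(W₁.geomPrimaryTorsion p) v)
    (e : ↥(geomTorsion W (p : ℤ)) ≃+ ↥(geomTorsion W₁ (p : ℤ))) {g : absoluteGaloisGroup ℚ}
    (he : ∀ P : ↥(geomTorsion W (p : ℤ)), e (g • P) = g • e P) {a a₁ : ℕ}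
    (ha : ∀ m ∈ L.plus, p • m = 0 → g • m = a • m)
    (ha₁ : ∀ m ∈ L₁.plus, p • m = 0 → g • m = a₁ • m)
    {P : ↥(geomTorsion W (p : ℤ))} (hP0 : P ≠ 0)
    (hP : AddSubgroup.inclusion (geomTorsion_le_geomPrimaryTorsion W p) P ∈ L.plus)
    (hP₁ : AddSubgroup.inclusion (geomTorsion_le_geomPrimaryTorsion W₁ p) (e P) ∈ L₁.plus) :
    (a : ZMod p) = (a₁ : ZMod p) := by
  set y := AddSubgroup.inclusion (geomTorsion_le_geomPrimaryTorsion W₁ p) (e P) with hy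
  have hyp : p • y = 0 := nsmul_inclusion_eq_zero (e P)
  -- `g • y = a • y` (transport of the line scalar of `E` along `e`)
  have h1 := ha _ hP (nsmul_inclusion_eq_zero P)
  have h2 : g • P = a • P :=
    Subtype.ext (by
      have h := congrArg Subtype.val h1
      simpa only [primaryComponent.coe_smul, AddSubmonoidClass.coe_nsmul,
        AddSubgroup.coe_inclusion, AddSubgroup.torsionBy.coe_smul] using h)
  have h3 : g • e P = a • e P := by rw [← he, h2, map_nsmul]
  have h4 : g • y = a • y := by
    rw [hy, ← TateLineDecomposition.inclusion_smul, h3, map_nsmul]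
  -- `g • y = a₁ • y` (line scalar of `E₁`)
  have h5 : g • y = a₁ • y := ha₁ y hP₁ hyp
  -- `y ≠ 0` has order `p`
  have hy0 : y ≠ 0 := by
    intro h
    apply hP0
    have h' : ((e P : ↥(geomTorsion W₁ (p : ℤ))) : W₁.geomPoints) = 0 := by
      have h2 := congrArg Subtype.val h
      rw [hy, AddSubgroup.coe_inclusion] at h2
      simpa only [ZeroMemClass.coe_zero] using h2
    have h'' : e P = 0 := Subtype.ext h'
    exact e.injective (by rw [h'', map_zero])
  have hord : addOrderOf y = p := addOrderOf_eq_prime hyp hy0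
  have hz : (((a : ℕ) : ℤ) - a₁) • y = 0 := by
    rw [sub_smul, natCast_zsmul, natCast_zsmul, ← h4, h5, sub_self]
  have hdvd : (p : ℤ) ∣ ((a : ℕ) : ℤ) - a₁ := by
    rw [← hord]; exact (addOrderOf_dvd_iff_zsmul_eq_zero).mpr hz
  have h0 : ((((a : ℕ) : ℤ) - a₁ : ℤ) : ZMod p) = 0 := (ZMod.intCast_zmod_eq_zero_iff_dvd _ p).mpr hdvd
  rw [Int.cast_sub, Int.cast_natCast, Int.cast_natCast, sub_eq_zero] at h0
  exact h0

end Summit.BirchSwinnertonDyer.Rank1Residual.Additive.RamifiedOrdinaryLineNoMatchingMixedParity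

/-! ## §2. No matching from a line exponent on `E` and a quotient exponent on `E₁` -/

namespace Literature.NumberTheory.EllipticCurves.EmertonPollackWeston2006.IsRamifiedOrdinaryLine

open Summit.BirchSwinnertonDyer.Rank1Residual.Additive.RamifiedOrdinaryLineMatchingModelFree
  Summit.BirchSwinnertonDyer.Rank1Residual.Additive.RamifiedOrdinaryLineInertiaScalars
  Summit.BirchSwinnertonDyer.Rank1Residual.Additive.RamifiedOrdinaryLineMatchingLineExponent
  Summit.BirchSwinnertonDyer.Rank1Residual.Additive.RamifiedOrdinaryLineNoMatchingMixedParity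

variable {W W₁ : WeierstrassCurve ℚ} [W.IsElliptic] [W₁.IsElliptic] {p : ℕ} [hp : Fact p.Prime]
  {v : HeightOneSpectrum (𝓞 ℚ)}

/-- **NO MATCHING from a line exponent `ℓ` on `E` and a quotient exponent `n₁` on `E₁` with
`(p − 1) ∤ lcm(ℓ, n₁)`.** `E, E₁` elliptic over `ℚ`, `v ∋ p`; `L`, `L₁` ramified ordinary lines at
`v`; the local inertia group acts on `C ∩ E[p^∞][p]` through exponent `ℓ` and on `E₁[p^∞]/C₁`
through exponent `n₁`, `(p − 1) ∤ lcm(ℓ, n₁)`. Then for EVERY inertia-equivariant additive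
`e : E[p] ≃ E₁[p]` the lines do NOT match: `¬ ∀ P, (P ∈ C ↔ e P ∈ C₁)`. (Take `σ ∈ I_v` with
`χ_p(σ) ≡ g₀` primitive; a non-zero `P ∈ C ∩ E[p]` would have `e P ∈ C₁`, so the line scalars of
`σ` on `E`, `E₁` agree; `a^ℓ ≡ 1`, `b₁^{n₁} ≡ 1`, `a b₁ ≡ g₀` ⇒ `g₀^{lcm} ≡ 1`.) EPW's hypothesis
"the congruence respects the `p`-stabilisations" FAILS on such pairs.
[cite: GreenbergVatsal2000, §2 p. 26 and Remark (2.9)]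
[cite: EmertonPollackWeston2006, pp. 2–3 and §3.1 (eq:ordes) (arXiv:math/0404484 p. 17)]
[cite: SilvermanAEC2009, Prop. III.8.1] -/
theorem not_forall_mem_iff_of_linePow_of_quotPow
    {L : LocalDatum ℚ ↥(W.geomPrimaryTorsion p) v} {L₁ : LocalDatum ℚ ↥(W₁.geomPrimaryTorsion p) v}
    (hL : IsRamifiedOrdinaryLine W p L) (hL₁ : IsRamifiedOrdinaryLine W₁ p L₁)
    (hpv : ((p : ℕ) : 𝓞 ℚ) ∈ v.asIdeal) {ℓ n₁ : ℕ}
    (hℓ : ∀ σ ∈ absInertia (v.adicCompletion ℚ), ∀ m ∈ L.plus, p • m = 0 →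
      (absGaloisRestrict ℚ (v.adicCompletion ℚ) σ) ^ ℓ • m = m)
    (hn₁ : ∀ σ ∈ absInertia (v.adicCompletion ℚ), ∀ m : ↥(W₁.geomPrimaryTorsion p),
      (absGaloisRestrict ℚ (v.adicCompletion ℚ) σ) ^ n₁ • m - m ∈ L₁.plus)
    (hlcm : ¬ (p - 1) ∣ Nat.lcm ℓ n₁)
    (e : ↥(geomTorsion W (p : ℤ)) ≃+ ↥(geomTorsion W₁ (p : ℤ)))
    (he : ∀ σ ∈ absInertia (v.adicCompletion ℚ), ∀ P : ↥(geomTorsion W (p : ℤ)),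
      e (absGaloisRestrict ℚ (v.adicCompletion ℚ) σ • P) =
        absGaloisRestrict ℚ (v.adicCompletion ℚ) σ • e P) :
    ¬ ∀ P : ↥(geomTorsion W (p : ℤ)),
      (AddSubgroup.inclusion (geomTorsion_le_geomPrimaryTorsion W p) P ∈ L.plus ↔
        AddSubgroup.inclusion (geomTorsion_le_geomPrimaryTorsion W₁ p) (e P) ∈ L₁.plus) := by
  intro hmatch
  obtain ⟨σ, hσI, g₀, hχ, u, hug₀, hu⟩ :=
    exists_mem_absInertia_cyclotomicCharacter_primitiveRoot (p := p) hpv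
  -- scalars
  obtain ⟨a, ha⟩ := exists_lineScalar hL σ
  obtain ⟨a₁, ha₁⟩ := exists_lineScalar hL₁ σ
  obtain ⟨x₁, hx₁0, hx₁p, hx₁gen⟩ := exists_quotGenerator hL₁
  obtain ⟨b₁, hb₁x, hb₁⟩ := exists_quotScalar σ hx₁p hx₁gen
  have haℓ : ((a : ZMod p)) ^ ℓ = 1 := lineScalar_pow_eq_one hL σ (hℓ σ hσI) ha
  have hb₁n : ((b₁ : ZMod p)) ^ n₁ = 1 := quotScalar_pow_eq_one σ (hn₁ σ hσI) hx₁0 hx₁p hb₁x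
  have hab₁ : ((b₁ : ZMod p)) * (a₁ : ZMod p) = (g₀ : ZMod p) :=
    quotScalar_mul_lineScalar_eq_of_cyclotomicCharacter_eq hL₁ hχ ha₁ hb₁
  rw [← hug₀] at hab₁
  -- the line scalars agree, via a non-zero matched point
  obtain ⟨P, hP0, hP⟩ := exists_ne_zero_inclusion_mem hL
  have haa₁ : (a : ZMod p) = (a₁ : ZMod p) :=
    lineScalar_eq_of_mem_of_mem L L₁ e (he σ hσI) ha ha₁ hP0 hP ((hmatch P).mp hP)
  -- `u^{lcm} = 1`
  apply hlcm
  rw [← hu, orderOf_dvd_iff_pow_eq_one]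
  apply Units.ext
  obtain ⟨k, hk⟩ := Nat.dvd_lcm_left ℓ n₁
  obtain ⟨k₁, hk₁⟩ := Nat.dvd_lcm_right ℓ n₁
  have h1 : ((a₁ : ZMod p)) ^ Nat.lcm ℓ n₁ = 1 := by rw [← haa₁, hk, pow_mul, haℓ, one_pow]
  have h2 : ((b₁ : ZMod p)) ^ Nat.lcm ℓ n₁ = 1 := by
    conv_lhs => rw [hk₁]
    rw [pow_mul, hb₁n, one_pow]
  rw [Units.val_pow_eq_pow_val, ← hab₁, Units.val_one, mul_pow, h1, h2, mul_one]

/-- **The symmetric form**: a quotient exponent `n` on `E` and a line exponent `ℓ₁` on `E₁` with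
`(p − 1) ∤ lcm(n, ℓ₁)` also forbid matching (apply the previous theorem to `e.symm`).
[cite: GreenbergVatsal2000, §2 p. 26 and Remark (2.9)] -/
theorem not_forall_mem_iff_of_quotPow_of_linePow
    {L : LocalDatum ℚ ↥(W.geomPrimaryTorsion p) v} {L₁ : LocalDatum ℚ ↥(W₁.geomPrimaryTorsion p) v}
    (hL : IsRamifiedOrdinaryLine W p L) (hL₁ : IsRamifiedOrdinaryLine W₁ p L₁)
    (hpv : ((p : ℕ) : 𝓞 ℚ) ∈ v.asIdeal) {n ℓ₁ : ℕ}
    (hn : ∀ σ ∈ absInertia (v.adicCompletion ℚ), ∀ m : ↥(W.geomPrimaryTorsion p),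
      (absGaloisRestrict ℚ (v.adicCompletion ℚ) σ) ^ n • m - m ∈ L.plus)
    (hℓ₁ : ∀ σ ∈ absInertia (v.adicCompletion ℚ), ∀ m ∈ L₁.plus, p • m = 0 →
      (absGaloisRestrict ℚ (v.adicCompletion ℚ) σ) ^ ℓ₁ • m = m)
    (hlcm : ¬ (p - 1) ∣ Nat.lcm n ℓ₁)
    (e : ↥(geomTorsion W (p : ℤ)) ≃+ ↥(geomTorsion W₁ (p : ℤ)))
    (he : ∀ σ ∈ absInertia (v.adicCompletion ℚ), ∀ P : ↥(geomTorsion W (p : ℤ)),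
      e (absGaloisRestrict ℚ (v.adicCompletion ℚ) σ • P) =
        absGaloisRestrict ℚ (v.adicCompletion ℚ) σ • e P) :
    ¬ ∀ P : ↥(geomTorsion W (p : ℤ)),
      (AddSubgroup.inclusion (geomTorsion_le_geomPrimaryTorsion W p) P ∈ L.plus ↔
        AddSubgroup.inclusion (geomTorsion_le_geomPrimaryTorsion W₁ p) (e P) ∈ L₁.plus) := by
  intro hmatch
  have he' : ∀ σ ∈ absInertia (v.adicCompletion ℚ), ∀ Q : ↥(geomTorsion W₁ (p : ℤ)),
      e.symm (absGaloisRestrict ℚ (v.adicCompletion ℚ) σ • Q) =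
        absGaloisRestrict ℚ (v.adicCompletion ℚ) σ • e.symm Q := fun σ hσ Q ↦
    e.injective (by rw [e.apply_symm_apply, he σ hσ, e.apply_symm_apply])
  refine hL₁.not_forall_mem_iff_of_linePow_of_quotPow hL hpv hℓ₁ hn
    (by rwa [Nat.lcm_comm] at hlcm) e.symm he' (fun Q ↦ ?_)
  have h := hmatch (e.symm Q)
  rw [e.apply_symm_apply] at h
  exact h.symm

/-- **MIXED PARITY ⇒ NO MATCHING** (`p` odd): `E` line-even (exponent `(p−1)/2` on `C ∩ E[p^∞][p]`)
and `E₁` quotient-even (exponent `(p−1)/2` on `E₁[p^∞]/C₁`) ⇒ no inertia-equivariant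
`e : E[p] ≃ E₁[p]` matches the lines — the genuine swap locus of S4's parity dictionary (e.g.
`(5; 4, 2)`, `(5; 4, M)`, `(5; 4, good)`, `(7; 6, 3)`, `(7; 6, good)`, `(13; 4, 3)`), modulo the
per-curve producers of the two exponents. [cite: GreenbergVatsal2000, §2 p. 26 and Remark (2.9)]
[cite: EmertonPollackWeston2006, pp. 2–3 and §3.1 (eq:ordes) (arXiv:math/0404484 p. 17)] -/
theorem not_forall_mem_iff_of_lineHalfPow_of_quotHalfPow
    {L : LocalDatum ℚ ↥(W.geomPrimaryTorsion p) v} {L₁ : LocalDatum ℚ ↥(W₁.geomPrimaryTorsion p) v}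
    (hp2 : p ≠ 2) (hL : IsRamifiedOrdinaryLine W p L) (hL₁ : IsRamifiedOrdinaryLine W₁ p L₁)
    (hpv : ((p : ℕ) : 𝓞 ℚ) ∈ v.asIdeal)
    (hℓ : ∀ σ ∈ absInertia (v.adicCompletion ℚ), ∀ m ∈ L.plus, p • m = 0 →
      (absGaloisRestrict ℚ (v.adicCompletion ℚ) σ) ^ ((p - 1) / 2) • m = m)
    (hn₁ : ∀ σ ∈ absInertia (v.adicCompletion ℚ), ∀ m : ↥(W₁.geomPrimaryTorsion p),
      (absGaloisRestrict ℚ (v.adicCompletion ℚ) σ) ^ ((p - 1) / 2) • m - m ∈ L₁.plus)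
    (e : ↥(geomTorsion W (p : ℤ)) ≃+ ↥(geomTorsion W₁ (p : ℤ)))
    (he : ∀ σ ∈ absInertia (v.adicCompletion ℚ), ∀ P : ↥(geomTorsion W (p : ℤ)),
      e (absGaloisRestrict ℚ (v.adicCompletion ℚ) σ • P) =
        absGaloisRestrict ℚ (v.adicCompletion ℚ) σ • e P) :
    ¬ ∀ P : ↥(geomTorsion W (p : ℤ)),
      (AddSubgroup.inclusion (geomTorsion_le_geomPrimaryTorsion W p) P ∈ L.plus ↔
        AddSubgroup.inclusion (geomTorsion_le_geomPrimaryTorsion W₁ p) (e P) ∈ L₁.plus) :=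
  hL.not_forall_mem_iff_of_linePow_of_quotPow hL₁ hpv hℓ hn₁ (not_sub_one_dvd_lcm_half_half hp2) e he

/-- **MIXED PARITY ⇒ NO MATCHING, other order**: `E` quotient-even and `E₁` line-even.
[cite: GreenbergVatsal2000, §2 p. 26 and Remark (2.9)] -/
theorem not_forall_mem_iff_of_quotHalfPow_of_lineHalfPow
    {L : LocalDatum ℚ ↥(W.geomPrimaryTorsion p) v} {L₁ : LocalDatum ℚ ↥(W₁.geomPrimaryTorsion p) v}
    (hp2 : p ≠ 2) (hL : IsRamifiedOrdinaryLine W p L) (hL₁ : IsRamifiedOrdinaryLine W₁ p L₁)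
    (hpv : ((p : ℕ) : 𝓞 ℚ) ∈ v.asIdeal)
    (hn : ∀ σ ∈ absInertia (v.adicCompletion ℚ), ∀ m : ↥(W.geomPrimaryTorsion p),
      (absGaloisRestrict ℚ (v.adicCompletion ℚ) σ) ^ ((p - 1) / 2) • m - m ∈ L.plus)
    (hℓ₁ : ∀ σ ∈ absInertia (v.adicCompletion ℚ), ∀ m ∈ L₁.plus, p • m = 0 →
      (absGaloisRestrict ℚ (v.adicCompletion ℚ) σ) ^ ((p - 1) / 2) • m = m)
    (e : ↥(geomTorsion W (p : ℤ)) ≃+ ↥(geomTorsion W₁ (p : ℤ)))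
    (he : ∀ σ ∈ absInertia (v.adicCompletion ℚ), ∀ P : ↥(geomTorsion W (p : ℤ)),
      e (absGaloisRestrict ℚ (v.adicCompletion ℚ) σ • P) =
        absGaloisRestrict ℚ (v.adicCompletion ℚ) σ • e P) :
    ¬ ∀ P : ↥(geomTorsion W (p : ℤ)),
      (AddSubgroup.inclusion (geomTorsion_le_geomPrimaryTorsion W p) P ∈ L.plus ↔
        AddSubgroup.inclusion (geomTorsion_le_geomPrimaryTorsion W₁ p) (e P) ∈ L₁.plus) :=
  hL.not_forall_mem_iff_of_quotPow_of_linePow hL₁ hpv hn hℓ₁ (not_sub_one_dvd_lcm_half_half hp2) e he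

end Literature.NumberTheory.EllipticCurves.EmertonPollackWeston2006.IsRamifiedOrdinaryLine

end
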